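/-
Copyright: rh-split cell (screw, prover seat l19) gen 0, 2026-08-27.  Splitting search over kernel-typed
RH-equivalences.  A splitting `A ∧ B ⟹ RH` is CONDITIONAL bookkeeping unless `A` and `B` are both
proved; nothing here bears on the truth of RH.
-/
import Summits.RiemannHypothesis.RiemannHypothesis.Theorems.Splittings.ScrewNoPorousPoleKernel
import Summits.RiemannHypothesis.RiemannHypothesis.Theorems.Splittings.ScrewLatticeContinuationB
import Summits.RiemannHypothesis.RiemannHypothesis.Theses.ScrewPorousWall
import HarnessLib

/-!
# Route X-12 `ScrewPorousWall` — item `NoPorousPole` PROVED (RH-free): under `CEIL(h)` no aliased pole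
is porously accessible from the origin's component

Objects of `ScrewLatticeContinuation` (row X-9): step `h > 0`, multipliers `u_ρ = e^{(ρ-1/2)h}` (`mult`),
coefficients `c_ρ = m(ρ)/(ρ-1/2)²` (`coeff`; `Re c_ρ < 0`, `∑ ‖c_ρ‖ < ∞`), the lattice generating function
`P_h(z) = ∑_k Ψ(k h) z^k` (`latticeGF`; holomorphic on `𝔻` under `CEIL(h)` = `LatticeCeiling h`, and equal
to the Borel series of the data for `‖z‖ < e^{-h/2}`, `latticeGF_eq_borel`), and the ALIASED POLE FIELD
`aliasedPoleSet h = {e^{∓(ρ-1/2)h}} ∩ 𝔻` with closure `T_h`; `Ω₀` = the connected component of `0` in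
`𝔻 ∖ T_h`.

**Theorem** (`noPorousPole_of_latticeCeiling`, closing `Theses.ScrewPorousWall.NoPorousPole` BY NAME as
`noPorousPole_proof`).  For every `h > 0` with `CEIL(h)`, every aliased pole `p`, every `κ > 0`: no sequence
`z_n → p` of points of `Ω₀` is `κ`-porous at `p` (`κ‖z_n - p‖ ≤ ‖q - z_n‖` for all `n` and all
`q ∈ T_h`, `q ≠ p`).  Quantitative form (`le_norm_sub_of_porous_of_latticeCeiling`): the `κ`-porous
points of `Ω₀` stay a positive distance `θ = θ(h, p, κ)` away from `p`; porosity is only required against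
the aliased poles themselves (not their closure).  The proof is the ζ-free kernel
`ScrewBorelPorous.le_norm_sub_of_porous` (fibre charge `Re C_p < 0` against the finite-set/ℓ¹-tail split
of the regular part) fed with the tree dictionary (`summable_norm_coeff`, `re_coeff_neg`, `mult_ne_zero`,
`differentiableOn_latticeGF`, `latticeGF_eq_borel`, `zero_mem_ball_diff_closure`).

This is the RH-FREE leg of the splitting X-12 `NoPorousPole ∧ PorousPole ∧ CEIL(1) ⟹ RH`; the other two
legs are open (RH-implied) conjectures.  RH is not proved by this; nothing here bears on the truth of RH.
No `sorry`, no new axioms, no instances, no notation.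
-/

set_option linter.dupNamespace false

namespace Summit.RiemannHypothesis.RiemannHypothesis.Theorems.Splittings.ScrewLatticePorous

open Complex Filter Topology Set Metric
open Summit.RiemannHypothesis.RiemannHypothesis.Theorems.Splittings
open Summit.RiemannHypothesis.RiemannHypothesis.Theorems.Splittings.ScrewBorel
open Summit.RiemannHypothesis.RiemannHypothesis.Theorems.Splittings.ScrewBorelPorous
open Summit.RiemannHypothesis.RiemannHypothesis.Theorems.Splittings.ScrewLatticeContinuation

/-- **Porous points of `Ω₀` stay away from every aliased pole** (`h > 0`, RH-free, quantitative).  Under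
`CEIL(h)`, for every aliased pole `p` and `κ > 0` there is `θ > 0` such that every point `z` of the
component `Ω₀` of `0` in `𝔻 ∖ T_h` with `κ‖z - p‖ ≤ ‖q - z‖` for all aliased poles `q ≠ p` satisfies
`θ ≤ ‖z - p‖`. -/
theorem le_norm_sub_of_porous_of_latticeCeiling {h : ℝ} (hh : 0 < h) (hceil : LatticeCeiling h)
    {p : ℂ} (hp : p ∈ aliasedPoleSet h) {κ : ℝ} (hκ : 0 < κ) :
    ∃ θ : ℝ, 0 < θ ∧ ∀ z ∈ connectedComponentIn (ball (0 : ℂ) 1 \ closure (aliasedPoleSet h)) 0,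
      (∀ q ∈ aliasedPoleSet h, q ≠ p → κ * ‖z - p‖ ≤ ‖q - z‖) → θ ≤ ‖z - p‖ :=
  le_norm_sub_of_porous (c := coeff) (u := mult h)
    (V := connectedComponentIn (ball (0 : ℂ) 1 \ closure (aliasedPoleSet h)) 0)
    summable_norm_coeff re_coeff_neg (mult_ne_zero h) (differentiableOn_latticeGF hceil)
    (Real.exp_pos (-(h / 2))) (fun _ hz ↦ latticeGF_eq_borel hh (mem_ball_zero_iff.1 hz))
    isPreconnected_connectedComponentIn (mem_connectedComponentIn (zero_mem_ball_diff_closure hh.le))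
    (connectedComponentIn_subset _ _) hp hκ

/-- **No porous access to an aliased pole** (`h > 0`, RH-free, sequence form).  Under `CEIL(h)`: for
every aliased pole `p`, `κ > 0` and sequence `z_n → p` in the component `Ω₀` of `0` in `𝔻 ∖ T_h` with
`κ‖z_n - p‖ ≤ ‖q - z_n‖` for all `n` and all aliased poles `q ≠ p` — contradiction. -/
theorem false_of_porous_access_of_latticeCeiling {h : ℝ} (hh : 0 < h) (hceil : LatticeCeiling h)
    {p : ℂ} (hp : p ∈ aliasedPoleSet h) {κ : ℝ} (hκ : 0 < κ) {z : ℕ → ℂ}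
    (hz : Tendsto z atTop (𝓝 p))
    (hzV : ∀ n, z n ∈ connectedComponentIn (ball (0 : ℂ) 1 \ closure (aliasedPoleSet h)) 0)
    (hpor : ∀ n, ∀ q ∈ aliasedPoleSet h, q ≠ p → κ * ‖z n - p‖ ≤ ‖q - z n‖) : False := by
  obtain ⟨θ, hθ, hfar⟩ := le_norm_sub_of_porous_of_latticeCeiling hh hceil hp hκ
  obtain ⟨N, hN⟩ := Metric.tendsto_atTop.1 hz θ hθ
  have h1 := hN N le_rfl
  rw [dist_eq_norm] at h1
  exact absurd (hfar (z N) (hzV N) (hpor N)) (not_le.2 h1)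

/-- **`NoPorousPole`** in the form filed on the route (porosity against the CLOSURE `T_h` of the aliased
pole field, which is weaker as a hypothesis on the sequence only in appearance: it implies porosity
against the poles themselves). -/
theorem noPorousPole_of_latticeCeiling {h : ℝ} (hh : 0 < h) (hceil : LatticeCeiling h)
    {p : ℂ} (hp : p ∈ aliasedPoleSet h) {κ : ℝ} (hκ : 0 < κ) {z : ℕ → ℂ}
    (hz : Tendsto z atTop (𝓝 p))
    (hzV : ∀ n, z n ∈ connectedComponentIn (ball (0 : ℂ) 1 \ closure (aliasedPoleSet h)) 0)
    (hpor : ∀ n, ∀ q ∈ closure (aliasedPoleSet h), q ≠ p → κ * ‖z n - p‖ ≤ ‖q - z n‖) : False :=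
  false_of_porous_access_of_latticeCeiling hh hceil hp hκ hz hzV
    fun n q hq hqp ↦ hpor n q (subset_closure hq) hqp

/-- **Item `NoPorousPole` of route `ScrewPorousWall` (X-12) — PROVED** (the route decl by name; RH-free:
the provable leg of the conditional splitting `NoPorousPole ∧ PorousPole ∧ CEIL(1) ⟹ RH`). -/
theorem noPorousPole_proof :
    Summit.RiemannHypothesis.RiemannHypothesis.Theses.ScrewPorousWall.NoPorousPole :=
  fun _ hh hceil _ hp _ hκ _ hz hzV hpor ↦ noPorousPole_of_latticeCeiling hh hceil hp hκ hz hzV hpor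

end Summit.RiemannHypothesis.RiemannHypothesis.Theorems.Splittings.ScrewLatticePorous
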